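import Summits.AtomisticToContinuum.Crystallization.Theorems.ThreeConeCertificateExactCertificateSlacknessEnergy

/-!
# `ExactCertificate` (stmt-AtomisticToContinuum-11959): lattice periodisation of a positive-type
# radial kernel, 0 — every coset family is absolutely summable

Line `closure-makes-nogap-exact`, necessity side (c1 lead).  Let `f : ℝ → ℝ` be radially of
positive type on `ℝ³` (clause (S4) of the crux: all finite Gram forms
`Σᵢⱼ wᵢ wⱼ f(dist yᵢ yⱼ) ≥ 0`) and eventually non-positive (`f ≤ 0` on `[R,∞)`; every split has
this with `R = max ρ 1`, since `f ≤ V_LJ ≤ 0` there).  Then for EVERY offset `v ∈ ℝ³` — not only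
for points of the configuration — the coset family `d ↦ f(dist v (latVec P d))` over the lattice of
periods of a periodic configuration `P` is absolutely summable (`summable_coset`).

Proof (Følner/Gram, no Fourier analysis): test positive type on the lattice box `[0,K)³` together
with its translate by `v`: `2·Σ_{k,k'} f(|latVec(k'−k)|) + 2·Σ_{k,k'} f(dist v (latVec(k'−k))) ≥ 0`.
Every row of either double sum is `≤ N·f 0` (only the finitely many lattice points within `R` of the
offset contribute positively, each at most `f 0`), and a `D`-deep row contains every difference `d`
with `|dᵢ| < D` exactly once; with `K = 3D` (`≥ D³ = K³/27` deep rows) every finite partial sum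
`Σ_{d ∈ A} f(dist v (latVec d))` is `≥ −27(N₀ + N_v)·f 0`, whence absolute summability. `[folklore]`.
-/

noncomputable section

namespace Summit.AtomisticToContinuum.Crystallization.Theorems.ThreeConeCertificateExactCertificate.Field

open Literature.MathematicalPhysics.StatisticalMechanics
open Summit.AtomisticToContinuum.Crystallization.Theorems.ChargedEnergyGapNegative (E3)
open Summit.AtomisticToContinuum.Crystallization.Theorems.ChargedEnergyGapNegative.Blocks
  (latVec latVec_mem latVec_add latVec_sub latVec_neg latVec_zero latVec_injective exists_latVec_eq
    coords coords_injective IsDeep card_not_deep_le)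
open Summit.AtomisticToContinuum.Crystallization.Theorems.ExactCertificateNegative (ax dist_ax)
open Summit.AtomisticToContinuum.Crystallization.Theorems.ExactCertificateNegative.IsSplit (quad_two)
open Filter Topology
open scoped BigOperators

/-! ## Positive type: elementary consequences -/

section PosType

variable {f : ℝ → ℝ}
  (hpd : ∀ (n : ℕ) (y : Fin n → E3) (w : Fin n → ℝ), 0 ≤ ∑ i, ∑ j, w i * w j * f (dist (y i) (y j)))
include hpd

/-- Positive type holds for Gram forms indexed by any finite type. [folklore] -/
theorem gram_nonneg {ι : Type*} [Fintype ι] (y : ι → E3) (w : ι → ℝ) :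
    0 ≤ ∑ i, ∑ j, w i * w j * f (dist (y i) (y j)) := by
  classical
  set e := (Fintype.equivFin ι).symm with he
  have h := hpd (Fintype.card ι) (y ∘ e) (w ∘ e)
  have h1 : ∑ i : Fin (Fintype.card ι), ∑ j : Fin (Fintype.card ι),
      (w ∘ e) i * (w ∘ e) j * f (dist ((y ∘ e) i) ((y ∘ e) j)) =
      ∑ i : ι, ∑ j : ι, w i * w j * f (dist (y i) (y j)) := by
    calc _ = ∑ i : Fin (Fintype.card ι), ∑ j : ι, w (e i) * w j * f (dist (y (e i)) (y j)) :=
          Finset.sum_congr rfl fun i _ =>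
            e.sum_comp (fun j => w (e i) * w j * f (dist (y (e i)) (y j)))
      _ = _ := e.sum_comp (fun i => ∑ j : ι, w i * w j * f (dist (y i) (y j)))
  rw [h1] at h
  exact h

/-- `0 ≤ f 0`. [folklore] -/
theorem f_zero_nonneg : 0 ≤ f 0 := by
  have h1 := hpd 1 (fun _ => 0) (fun _ => 1)
  simpa using h1

/-- `|f r| ≤ f 0` for `r ≥ 0` (two-point forms). [folklore] -/
theorem abs_le_f_zero {r : ℝ} (hr : 0 ≤ r) : |f r| ≤ f 0 := by
  have h1 := hpd 2 ![ax 0, ax r] ![1, 1]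
  have h2 := hpd 2 ![ax 0, ax r] ![1, -1]
  rw [quad_two, abs_of_nonneg hr] at h1 h2
  rw [abs_le]
  constructor <;> nlinarith

/-- Every value of the kernel is at most `f 0`. [folklore] -/
theorem apply_dist_le_f_zero (v w : E3) : f (dist v w) ≤ f 0 :=
  (le_abs_self _).trans (abs_le_f_zero hpd dist_nonneg)
end PosType

/-! ## Geometry of the lattice boxes -/

section Boxes

variable (P : PeriodicConfiguration 3)

/-- The basic distance identity: `dist (v + latVec c) (latVec c') = dist v (latVec (c' − c))`.
[folklore] -/
theorem dist_add_latVec (v : E3) (c c' : Fin 3 → ℤ) :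
    dist (v + latVec P c) (latVec P c') = dist v (latVec P (c' - c)) := by
  rw [latVec_sub, dist_eq_norm, dist_eq_norm]
  congr 1
  abel

/-- Only finitely many lattice vectors lie within `R` of a given offset. [folklore] -/
theorem finite_near (v : E3) (R : ℝ) : {d : Fin 3 → ℤ | dist v (latVec P d) < R}.Finite := by
  obtain ⟨x₀, hx₀⟩ := P.motif_nonempty
  have hfin := P.finite_inter_points (Metric.isBounded_ball (x := x₀ + v) (r := R))
  have hinj : Set.InjOn (fun d : Fin 3 → ℤ => x₀ + latVec P d)
      ((fun d : Fin 3 → ℤ => x₀ + latVec P d) ⁻¹' (Metric.ball (x₀ + v) R ∩ P.points)) :=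
    fun d _ d' _ h => latVec_injective P (add_left_cancel h)
  refine (hfin.preimage hinj).subset fun d hd => ?_
  refine ⟨?_, P.add_mem_points (P.mem_points_of_mem_motif hx₀) (latVec_mem P d)⟩
  rw [Metric.mem_ball]
  have : dist (x₀ + latVec P d) (x₀ + v) = dist v (latVec P d) := by
    rw [dist_add_left, dist_comm]
  rw [this]
  exact hd

/-- A `D`-deep box index reaches every difference vector with coordinates in `(−D, D)`.
[folklore] -/
theorem exists_index_of_deep {K D : ℕ} {k : Fin 3 → Fin K} (hk : IsDeep K D k)
    {d : Fin 3 → ℤ} (hd : ∀ i, -(D : ℤ) < d i ∧ d i < D) :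
    ∃ k' : Fin 3 → Fin K, coords K k' - coords K k = d := by
  have hnn : ∀ i, 0 ≤ ((k i : ℕ) : ℤ) + d i := fun i => by
    have := (hk i).1; have := (hd i).1; omega
  have hlt : ∀ i, (((k i : ℕ) : ℤ) + d i).toNat < K := fun i => by
    have h1 := (hk i).2; have h2 := (hd i).2
    have h3 : ((k i : ℕ) : ℤ) + d i < K := by omega
    exact (Int.toNat_lt (hnn i)).2 h3
  refine ⟨fun i => ⟨(((k i : ℕ) : ℤ) + d i).toNat, hlt i⟩, ?_⟩
  funext i
  simp only [Pi.sub_apply, coords]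
  rw [Int.toNat_of_nonneg (hnn i)]
  ring

/-- For `K = 3D` at least `D³` box indices are `D`-deep. [folklore] -/
theorem card_deep_ge (D : ℕ) :
    D ^ 3 ≤ (Finset.univ.filter fun k : Fin 3 → Fin (3 * D) => IsDeep (3 * D) D k).card := by
  classical
  have h := Finset.card_le_card_of_injOn
    (s := (Finset.univ : Finset (Fin 3 → Fin D)))
    (t := Finset.univ.filter fun k : Fin 3 → Fin (3 * D) => IsDeep (3 * D) D k)
    (fun j : Fin 3 → Fin D => fun i => (⟨D + (j i : ℕ), by have := (j i).2; omega⟩ : Fin (3 * D)))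
    (fun j _ => by
      rw [Finset.coe_filter]
      refine ⟨Finset.mem_univ _, fun i => ⟨?_, ?_⟩⟩
      · simp
      · have := (j i).2
        simp only
        omega)
    (fun j _ j' _ h => by
      funext i
      have h1 := congrArg (fun k : Fin 3 → Fin (3 * D) => ((k i : ℕ))) h
      simp only at h1
      exact Fin.ext (by omega))
  simpa [Fintype.card_fun, Fintype.card_fin] using h
end Boxes

/-! ## Row bounds -/

section Rows

variable (P : PeriodicConfiguration 3) {f : ℝ → ℝ}
  (hpd : ∀ (n : ℕ) (y : Fin n → E3) (w : Fin n → ℝ), 0 ≤ ∑ i, ∑ j, w i * w j * f (dist (y i) (y j)))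
  {R : ℝ} (hR : ∀ r : ℝ, R ≤ r → f r ≤ 0)
include hpd hR

/-- **Finite partial sums of a coset family are bounded above**: only the (finitely many) lattice
vectors within `R` of the offset contribute positively, each at most `f 0`. [folklore] -/
theorem sum_coset_le (v : E3) (A : Finset (Fin 3 → ℤ)) :
    ∑ d ∈ A, f (dist v (latVec P d)) ≤ (finite_near P v R).toFinset.card * f 0 := by
  classical
  rw [← Finset.sum_filter_add_sum_filter_not A (fun d => dist v (latVec P d) < R)]
  have h1 : ∑ d ∈ A.filter (fun d => dist v (latVec P d) < R), f (dist v (latVec P d)) ≤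
      (finite_near P v R).toFinset.card * f 0 := by
    calc _ ≤ ∑ _d ∈ A.filter (fun d => dist v (latVec P d) < R), f 0 :=
          Finset.sum_le_sum fun d _ => apply_dist_le_f_zero hpd _ _
      _ = (A.filter (fun d => dist v (latVec P d) < R)).card * f 0 := by
          rw [Finset.sum_const, nsmul_eq_mul]
      _ ≤ (finite_near P v R).toFinset.card * f 0 := by
          refine mul_le_mul_of_nonneg_right ?_ (f_zero_nonneg hpd)
          exact_mod_cast Finset.card_le_card fun d hd => by
            rw [Set.Finite.mem_toFinset]
            exact (Finset.mem_filter.1 hd).2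
  have h2 : ∑ d ∈ A.filter (fun d => ¬ dist v (latVec P d) < R), f (dist v (latVec P d)) ≤ 0 :=
    Finset.sum_nonpos fun d hd => hR _ (not_lt.1 (Finset.mem_filter.1 hd).2)
  linarith

/-- Every row of a box double sum is bounded above by `N_v · f 0`. [folklore] -/
theorem row_le (v : E3) (K : ℕ) (k : Fin 3 → Fin K) (s : Finset (Fin 3 → Fin K)) :
    ∑ k' ∈ s, f (dist v (latVec P (coords K k' - coords K k))) ≤
      (finite_near P v R).toFinset.card * f 0 := by
  classical
  have hinj : Set.InjOn (fun k' : Fin 3 → Fin K => coords K k' - coords K k) s :=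
    fun a _ b _ h => coords_injective K (sub_left_inj.1 h)
  rw [← Finset.sum_image (f := fun d => f (dist v (latVec P d))) hinj]
  exact sum_coset_le P hpd hR v _

/-- **A deep row contains every small difference exactly once**: for a `D`-deep index `k` and a
finite set `A` of differences with coordinates in `(−D, D)`,
`Row_v(k) ≤ Σ_{d ∈ A} f(dist v (latVec d)) + N_v · f 0`. [folklore] -/
theorem row_le_of_deep (v : E3) {K D : ℕ} {k : Fin 3 → Fin K} (hk : IsDeep K D k)
    (A : Finset (Fin 3 → ℤ)) (hA : ∀ d ∈ A, ∀ i, -(D : ℤ) < d i ∧ d i < D) :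
    ∑ k' : Fin 3 → Fin K, f (dist v (latVec P (coords K k' - coords K k))) ≤
      ∑ d ∈ A, f (dist v (latVec P d)) + (finite_near P v R).toFinset.card * f 0 := by
  classical
  set φ : (Fin 3 → Fin K) → (Fin 3 → ℤ) := fun k' => coords K k' - coords K k with hφ
  have hinj : Function.Injective φ := fun a b h => coords_injective K (sub_left_inj.1 h)
  rw [← Finset.sum_filter_add_sum_filter_not Finset.univ (fun k' => φ k' ∈ A)]
  have himage : (Finset.univ.filter fun k' => φ k' ∈ A).image φ = A := by
    ext d
    constructor
    · intro hd
      obtain ⟨k', hk', rfl⟩ := Finset.mem_image.1 hd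
      exact (Finset.mem_filter.1 hk').2
    · intro hd
      obtain ⟨k', hk'⟩ := exists_index_of_deep hk (hA d hd)
      refine Finset.mem_image.2 ⟨k', Finset.mem_filter.2 ⟨Finset.mem_univ _, ?_⟩, hk'⟩
      show φ k' ∈ A
      rw [hφ]; simpa [hk'] using hd
  have h1 : ∑ k' ∈ Finset.univ.filter (fun k' => φ k' ∈ A), f (dist v (latVec P (φ k'))) =
      ∑ d ∈ A, f (dist v (latVec P d)) := by
    rw [← Finset.sum_image (f := fun d => f (dist v (latVec P d))) (fun a _ b _ h => hinj h),
      himage]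
  have h2 := row_le P hpd hR v K k (Finset.univ.filter fun k' => ¬ φ k' ∈ A)
  simp only [hφ] at h1 h2 ⊢
  linarith
end Rows

/-! ## The two-copy Gram inequality and the lower bound on partial sums -/

section Gram

variable (P : PeriodicConfiguration 3) {f : ℝ → ℝ}
  (hpd : ∀ (n : ℕ) (y : Fin n → E3) (w : Fin n → ℝ), 0 ≤ ∑ i, ∑ j, w i * w j * f (dist (y i) (y j)))
include hpd

/-- **Two-copy Gram inequality.** Testing positive type on the lattice box `[0,K)³` together with
its translate by `v` (all weights `1`):
`0 ≤ Σ_{k,k'} f(dist 0 (latVec(k'−k))) + Σ_{k,k'} f(dist v (latVec(k'−k)))`. [folklore] -/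
theorem gram_two_copies (v : E3) (K : ℕ) :
    0 ≤ ∑ k : Fin 3 → Fin K, ∑ k' : Fin 3 → Fin K,
          f (dist (0 : E3) (latVec P (coords K k' - coords K k))) +
        ∑ k : Fin 3 → Fin K, ∑ k' : Fin 3 → Fin K,
          f (dist v (latVec P (coords K k' - coords K k))) := by
  set y : (Fin 3 → Fin K) ⊕ (Fin 3 → Fin K) → E3 :=
    fun i => Sum.elim (fun k => v + latVec P (coords K k)) (fun k => latVec P (coords K k)) i with hy
  have h := gram_nonneg hpd y (fun _ => (1 : ℝ))
  simp only [one_mul, Fintype.sum_sum_type, hy, Sum.elim_inl, Sum.elim_inr] at h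
  have h11 : ∀ k k' : Fin 3 → Fin K, dist (v + latVec P (coords K k)) (v + latVec P (coords K k')) =
      dist (0 : E3) (latVec P (coords K k' - coords K k)) := fun k k' => by
    rw [dist_add_left, ← dist_add_latVec P 0, zero_add]
  have h22 : ∀ k k' : Fin 3 → Fin K, dist (latVec P (coords K k)) (latVec P (coords K k')) =
      dist (0 : E3) (latVec P (coords K k' - coords K k)) := fun k k' => by
    rw [← dist_add_latVec P 0, zero_add]
  have h12 : ∀ k k' : Fin 3 → Fin K, dist (v + latVec P (coords K k)) (latVec P (coords K k')) =
      dist v (latVec P (coords K k' - coords K k)) := fun k k' => dist_add_latVec P v _ _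
  have h21 : ∀ k k' : Fin 3 → Fin K, dist (latVec P (coords K k)) (v + latVec P (coords K k')) =
      dist v (latVec P (coords K k - coords K k')) := fun k k' => by
    rw [dist_comm]; exact dist_add_latVec P v _ _
  simp only [h11, h22, h12, h21, Finset.sum_add_distrib] at h
  have hswap : ∑ k : Fin 3 → Fin K, ∑ k' : Fin 3 → Fin K,
      f (dist v (latVec P (coords K k - coords K k'))) =
      ∑ k : Fin 3 → Fin K, ∑ k' : Fin 3 → Fin K, f (dist v (latVec P (coords K k' - coords K k))) :=
    Finset.sum_comm
  rw [hswap] at h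
  linarith

variable {R : ℝ} (hR : ∀ r : ℝ, R ≤ r → f r ≤ 0)
include hR

/-- **Uniform lower bound on the finite partial sums of a coset family**:
`−27·(N₀ + N_v)·f 0 ≤ Σ_{d ∈ A} f(dist v (latVec d))` for every finite `A`. [folklore] -/
theorem neg_le_sum_coset (v : E3) (A : Finset (Fin 3 → ℤ)) :
    -(27 * (((finite_near P (0 : E3) R).toFinset.card : ℝ) + (finite_near P v R).toFinset.card) * f 0) ≤
      ∑ d ∈ A, f (dist v (latVec P d)) := by
  classical
  set N₀ : ℝ := ((finite_near P (0 : E3) R).toFinset.card : ℝ) with hN₀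
  set Nv : ℝ := ((finite_near P v R).toFinset.card : ℝ) with hNv
  set S : ℝ := ∑ d ∈ A, f (dist v (latVec P d)) with hS
  have hf0 := f_zero_nonneg hpd
  have hN₀0 : 0 ≤ N₀ := by positivity
  by_cases hS0 : 0 ≤ S
  · nlinarith
  push Not at hS0
  -- a depth exceeding all coordinates of `A`
  set D : ℕ := A.sup (fun d => Finset.univ.sup fun i => (d i).natAbs) + 1 with hD
  have hA : ∀ d ∈ A, ∀ i, -(D : ℤ) < d i ∧ d i < D := by
    intro d hd i
    have h1 : (d i).natAbs ≤ A.sup (fun d => Finset.univ.sup fun i => (d i).natAbs) :=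
      (Finset.le_sup (f := fun i => (d i).natAbs) (Finset.mem_univ i)).trans
        (Finset.le_sup (f := fun d => Finset.univ.sup fun i => (d i).natAbs) hd)
    rw [hD]; omega
  set K : ℕ := 3 * D with hK
  -- the Gram inequality for the box of side `K = 3D`
  have hgram := gram_two_copies P hpd v K
  -- first double sum: every row `≤ N₀ f 0`
  have hA0 : ∑ k : Fin 3 → Fin K, ∑ k' : Fin 3 → Fin K,
      f (dist (0 : E3) (latVec P (coords K k' - coords K k))) ≤ (K : ℝ) ^ 3 * (N₀ * f 0) := by
    calc _ ≤ ∑ _k : Fin 3 → Fin K, N₀ * f 0 :=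
          Finset.sum_le_sum fun k _ => row_le P hpd hR 0 K k Finset.univ
      _ = _ := by
          rw [Finset.sum_const, Finset.card_univ, Fintype.card_fun, Fintype.card_fin, Fintype.card_fin,
            nsmul_eq_mul]
          push_cast; ring
  -- second double sum: deep rows `≤ S + Nv f 0`, all rows `≤ Nv f 0`
  have hrow_deep : ∀ k ∈ Finset.univ.filter (fun k : Fin 3 → Fin K => IsDeep K D k),
      ∑ k' : Fin 3 → Fin K, f (dist v (latVec P (coords K k' - coords K k))) ≤ S + Nv * f 0 :=
    fun k hk => row_le_of_deep P hpd hR v (Finset.mem_filter.1 hk).2 A hA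
  have hrow_all : ∀ k : Fin 3 → Fin K, ∑ k' : Fin 3 → Fin K,
      f (dist v (latVec P (coords K k' - coords K k))) ≤ Nv * f 0 := fun k =>
    row_le P hpd hR v K k Finset.univ
  have hcardK : ((Finset.univ : Finset (Fin 3 → Fin K)).card : ℝ) = (K : ℝ) ^ 3 := by
    rw [Finset.card_univ, Fintype.card_fun, Fintype.card_fin, Fintype.card_fin]; push_cast; ring
  have hsplit := Finset.sum_filter_add_sum_filter_not (Finset.univ : Finset (Fin 3 → Fin K))
    (fun k => IsDeep K D k)
    (fun k => ∑ k' : Fin 3 → Fin K, f (dist v (latVec P (coords K k' - coords K k))))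
  have hcard_split := Finset.card_filter_add_card_filter_not
    (s := (Finset.univ : Finset (Fin 3 → Fin K))) (p := fun k => IsDeep K D k)
  set nd : ℝ := ((Finset.univ.filter fun k : Fin 3 → Fin K => IsDeep K D k).card : ℝ) with hnd
  set nn : ℝ := ((Finset.univ.filter fun k : Fin 3 → Fin K => ¬ IsDeep K D k).card : ℝ) with hnn
  have hndnn : nd + nn = (K : ℝ) ^ 3 := by
    rw [hnd, hnn, ← hcardK]; exact_mod_cast hcard_split
  have h1 : ∑ k ∈ Finset.univ.filter (fun k : Fin 3 → Fin K => IsDeep K D k),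
      ∑ k' : Fin 3 → Fin K, f (dist v (latVec P (coords K k' - coords K k))) ≤ nd * (S + Nv * f 0) := by
    calc _ ≤ ∑ _k ∈ Finset.univ.filter (fun k : Fin 3 → Fin K => IsDeep K D k), (S + Nv * f 0) :=
          Finset.sum_le_sum fun k hk => hrow_deep k hk
      _ = _ := by rw [Finset.sum_const, nsmul_eq_mul]
  have h2 : ∑ k ∈ Finset.univ.filter (fun k : Fin 3 → Fin K => ¬ IsDeep K D k),
      ∑ k' : Fin 3 → Fin K, f (dist v (latVec P (coords K k' - coords K k))) ≤ nn * (Nv * f 0) := by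
    calc _ ≤ ∑ _k ∈ Finset.univ.filter (fun k : Fin 3 → Fin K => ¬ IsDeep K D k), (Nv * f 0) :=
          Finset.sum_le_sum fun k _ => hrow_all k
      _ = _ := by rw [Finset.sum_const, nsmul_eq_mul]
  have hBv : ∑ k : Fin 3 → Fin K, ∑ k' : Fin 3 → Fin K,
      f (dist v (latVec P (coords K k' - coords K k))) ≤ nd * S + (K : ℝ) ^ 3 * (Nv * f 0) := by
    rw [← hsplit]
    calc _ ≤ nd * (S + Nv * f 0) + nn * (Nv * f 0) := add_le_add h1 h2
      _ = nd * S + (K : ℝ) ^ 3 * (Nv * f 0) := by rw [← hndnn]; ring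
  -- at least `D³ = K³/27` rows are deep
  have hnd_ge : (D : ℝ) ^ 3 ≤ nd := by
    rw [hnd]; exact_mod_cast card_deep_ge D
  have hK3 : (K : ℝ) ^ 3 = 27 * (D : ℝ) ^ 3 := by rw [hK]; push_cast; ring
  have hD3 : (0 : ℝ) < (D : ℝ) ^ 3 := by positivity
  -- combine: `0 ≤ K³(N₀ + Nv) f 0 + nd·S` and `nd·S ≤ D³·S`
  have hndS : nd * S ≤ (D : ℝ) ^ 3 * S := by nlinarith
  rw [hK3] at hA0 hBv
  have hmain : 0 ≤ 27 * (D : ℝ) ^ 3 * ((N₀ + Nv) * f 0) + (D : ℝ) ^ 3 * S := by linarith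
  have : 0 ≤ 27 * ((N₀ + Nv) * f 0) + S := by
    by_contra hlt
    push Not at hlt
    have : 27 * (D : ℝ) ^ 3 * ((N₀ + Nv) * f 0) + (D : ℝ) ^ 3 * S < 0 := by nlinarith
    linarith
  linarith

/-- **Every coset family of an eventually non-positive positive-type radial kernel is absolutely
summable**, at every offset `v ∈ ℝ³`. [folklore] -/
theorem summable_abs_coset (v : E3) : Summable fun d : Fin 3 → ℤ => |f (dist v (latVec P d))| := by
  classical
  set C : ℝ := 27 * (((finite_near P (0 : E3) R).toFinset.card : ℝ) +
      (finite_near P v R).toFinset.card) * f 0 with hC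
  set Nv : ℝ := ((finite_near P v R).toFinset.card : ℝ) with hNv
  refine summable_of_sum_le (c := Nv * f 0 + C) (fun _ => abs_nonneg _) fun A => ?_
  -- split `A` into the non-negative and the negative terms
  rw [← Finset.sum_filter_add_sum_filter_not A (fun d => 0 ≤ f (dist v (latVec P d)))]
  have hpos : ∑ d ∈ A.filter (fun d => 0 ≤ f (dist v (latVec P d))), |f (dist v (latVec P d))| ≤
      Nv * f 0 := by
    calc _ = ∑ d ∈ A.filter (fun d => 0 ≤ f (dist v (latVec P d))), f (dist v (latVec P d)) :=
          Finset.sum_congr rfl fun d hd => abs_of_nonneg (Finset.mem_filter.1 hd).2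
      _ ≤ _ := sum_coset_le P hpd hR v _
  have hneg : ∑ d ∈ A.filter (fun d => ¬ 0 ≤ f (dist v (latVec P d))), |f (dist v (latVec P d))| ≤
      C := by
    calc _ = ∑ d ∈ A.filter (fun d => ¬ 0 ≤ f (dist v (latVec P d))), -f (dist v (latVec P d)) :=
          Finset.sum_congr rfl fun d hd => abs_of_neg (not_le.1 (Finset.mem_filter.1 hd).2)
      _ = -∑ d ∈ A.filter (fun d => ¬ 0 ≤ f (dist v (latVec P d))), f (dist v (latVec P d)) :=
          Finset.sum_neg_distrib ..
      _ ≤ C := by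
          have := neg_le_sum_coset P hpd hR v (A.filter fun d => ¬ 0 ≤ f (dist v (latVec P d)))
          rw [hC]; linarith
  linarith

/-- Hence every coset family is summable. [folklore] -/
theorem summable_coset (v : E3) : Summable fun d : Fin 3 → ℤ => f (dist v (latVec P d)) :=
  Summable.of_norm (by simpa only [Real.norm_eq_abs] using summable_abs_coset P hpd hR v)

end Gram
/-! ## Splits are eventually non-positive -/

/-- The `f` of a split is non-positive on `[max ρ 1, ∞)` (`f ≤ V_LJ ≤ 0` there). [folklore] -/
theorem f_nonpos_of_isSplit {ρ c : ℝ} {g U f : ℝ → ℝ}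
    (h : Summit.AtomisticToContinuum.Crystallization.Theorems.ExactCertificateNegative.IsSplit ρ c g U f) :
    ∀ r : ℝ, max ρ 1 ≤ r → f r ≤ 0 := fun _ hr =>
  (h.f_le_tail ((le_max_left _ _).trans hr) (lt_of_lt_of_le one_pos ((le_max_right _ _).trans hr))).trans
    (lennardJones_nonpos ((le_max_right _ _).trans hr))

/-- **Every coset family of the `f` of a split is summable, at every offset.** [folklore] -/
theorem summable_coset_of_isSplit (P : PeriodicConfiguration 3) {ρ c : ℝ} {g U f : ℝ → ℝ}
    (h : Summit.AtomisticToContinuum.Crystallization.Theorems.ExactCertificateNegative.IsSplit ρ c g U f)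
    (v : E3) : Summable fun d : Fin 3 → ℤ => f (dist v (latVec P d)) :=
  summable_coset P h.posType (f_nonpos_of_isSplit h) v
/-- **Registered stub `stub_cosetSummable` of crux item stmt-AtomisticToContinuum-11959** (line
`closure-makes-nogap-exact`, necessity side; signature verbatim) = `summable_coset`. [folklore] -/
theorem stub_cosetSummable : ∀ (P : PeriodicConfiguration 3) (f : ℝ → ℝ),
    (∀ (n : ℕ) (y : Fin n → EuclideanSpace ℝ (Fin 3)) (w : Fin n → ℝ),
      0 ≤ ∑ i, ∑ j, w i * w j * f (dist (y i) (y j))) → ∀ R : ℝ, (∀ r : ℝ, R ≤ r → f r ≤ 0) →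
    ∀ v : EuclideanSpace ℝ (Fin 3), Summable fun d : Fin 3 → ℤ => f (dist v
      (Summit.AtomisticToContinuum.Crystallization.Theorems.ChargedEnergyGapNegative.Blocks.latVec P d)) :=
  fun P _ hpd _ hR v => summable_coset P hpd hR v

end Summit.AtomisticToContinuum.Crystallization.Theorems.ThreeConeCertificateExactCertificate.Field

end
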